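import Mathlib
import Summits.ValiantsHypothesis.ValiantsHypothesis.Theorems.FeketeSOSCharPSparseSOSTwoCuspJointSupport
import Summits.ValiantsHypothesis.ValiantsHypothesis.Theorems.FeketeSOSCharPSparseSOSStubFeketeCuspInf
import Summits.ValiantsHypothesis.ValiantsHypothesis.Theorems.FeketeSOSCharPSparseSOSStubFeketeCuspZero

/-!
# Crux `FeketeSOS.CharPSparseSOS` (stmt-ValiantsHypothesis-14989), line `Sketch` — stub `twoCusp_fullDepth_rigidity`

Rigidity of the two-cusp hypotheses at full depth.  In a field `K` of characteristic `p ≠ 2` write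
`M = (p-1)/2` and `F̄_p = Σ_{m<p} ((m|p) : K) X^m` (the crux's inlined reduced Fekete polynomial).
Line `Sketch` feeds the two-cusp inequality a fold `P` with `deg P < p` that is deep `≥ D` at the
upper cusp (`(X-1)^D ∣ P`) and deep `≥ D` at the lower cusp (`P_0 = 0` and vanishing top moments
`Σ_{n<p} P_n n^{p-1-d}`, `1 ≤ d < D`).  This file records that at FULL depth `D = M` these hypotheses
force `P ∈ Kˣ · F̄_p`: any non-zero such `P` is a non-zero scalar multiple of `F̄_p`, so the
composition `CharPSparseSOS_of` invokes the two-cusp inequality exactly where its hypotheses are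
equivalent to "`P` is a unit multiple of `F̄_p`" — the composition is lossless.

Proof.  Put `κ = P_1` and `R = P - κ F̄_p`.  Since `(F̄_p)_0 = (0|p) = 0` and `(F̄_p)_1 = (1|p) = 1`,
`R_0 = R_1 = 0`; `deg R < p`; `(X-1)^M ∣ R` (both `P` and `F̄_p` are divisible, the latter by
`stub_feketeCuspInf`); and the top moments of `R` vanish for `1 ≤ d < M` (linearity, using
`stub_feketeCuspZero` for `F̄_p`).  If `R ≠ 0`, the joint two-cusp support bound
(`twoCuspJointSupport`) gives `2M = p - 1 ≤ #supp R`, while `supp R ⊆ {2, …, p-1}` has at most `p - 2`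
elements — absurd.  Hence `R = 0`, i.e. `P = κ F̄_p`, and `κ ≠ 0` because `P ≠ 0`.
-/

-- `Summit.ValiantsHypothesis.ValiantsHypothesis.…` is the tree's mandated single-conjunct layout (Sub = Summit).
set_option linter.dupNamespace false

namespace Summit.ValiantsHypothesis.ValiantsHypothesis.Theorems.CharPSparseSOSTwoCusp

open Polynomial Finset

/-- **Full-depth rigidity of the two-cusp hypotheses.** Over a field `K` of characteristic `p ≠ 2`,
a non-zero `P : K[X]` with `natDegree P < p`, `(X - 1)^{(p-1)/2} ∣ P`, `P.coeff 0 = 0` and vanishing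
top moments `Σ_{n<p} P.coeff n * n^{p-1-d} = 0` for `1 ≤ d < (p-1)/2` is a non-zero scalar multiple
of the reduced Fekete polynomial `Σ_{m<p} ((m|p) : K) X^m` (subtract `P.coeff 1` times the Fekete
polynomial and apply the joint two-cusp support bound `twoCuspJointSupport` to the difference, whose
support misses `0` and `1`). -/
theorem twoCusp_fullDepth_rigidity :
    ∀ (K : Type) [Field K] (p : ℕ) [Fact p.Prime] [CharP K p] (P : K[X]), p ≠ 2 → P ≠ 0 →
      P.natDegree < p →
      (X - C (1 : K)) ^ ((p - 1) / 2) ∣ P → P.coeff 0 = 0 →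
      (∀ d : ℕ, 1 ≤ d → d < (p - 1) / 2 →
        ∑ n ∈ Finset.range p, P.coeff n * (n : K) ^ (p - 1 - d) = 0) →
      ∃ κ : K, κ ≠ 0 ∧ P = C κ * ∑ m ∈ Finset.range p, C ((legendreSym p m : ℤ) : K) * X ^ m := by
  intro K _ p _ _ P hp2 hP hdeg hdvd hP0 hmom
  classical
  have hp : p.Prime := Fact.out
  have hodd : p % 2 = 1 := hp.eq_two_or_odd.resolve_left hp2
  -- facts about the target `F = Σ_{m<p} ((m|p) : K) X^m`
  have hF1 : (∑ m ∈ Finset.range p, C ((legendreSym p m : ℤ) : K) * X ^ m).coeff 1 = 1 := by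
    rw [fcz_coeff_sum p 1 hp.one_lt, Nat.cast_one, legendreSym.at_one, Int.cast_one]
  have hFdeg : (∑ m ∈ Finset.range p, C ((legendreSym p m : ℤ) : K) * X ^ m).natDegree < p := by
    refine lt_of_le_of_lt (natDegree_sum_le_of_forall_le _ _ fun m hm => ?_)
      (Nat.sub_lt hp.pos one_pos)
    exact (natDegree_C_mul_X_pow_le _ _).trans (by have := mem_range.mp hm; omega)
  obtain ⟨hF0, hFmom, -⟩ := stub_feketeCuspZero K p hp2
  have hFinf := (stub_feketeCuspInf K p hp2).1
  set F := ∑ m ∈ Finset.range p, C ((legendreSym p m : ℤ) : K) * X ^ m with hFdef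
  -- the difference `R = P - P_1 • F`
  obtain ⟨R, hRdef⟩ : ∃ R : K[X], R = P - C (P.coeff 1) * F := ⟨_, rfl⟩
  have hR0 : R.coeff 0 = 0 := by
    rw [hRdef, coeff_sub, coeff_C_mul, hP0, hF0, mul_zero, sub_zero]
  have hR1 : R.coeff 1 = 0 := by
    rw [hRdef, coeff_sub, coeff_C_mul, hF1, mul_one, sub_self]
  have hRdeg : R.natDegree < p := by
    rw [hRdef]
    exact lt_of_le_of_lt (natDegree_sub_le _ _)
      (max_lt hdeg (lt_of_le_of_lt (natDegree_C_mul_le _ _) hFdeg))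
  have hRdvd : (X - C (1 : K)) ^ ((p - 1) / 2) ∣ R := by
    rw [hRdef]
    exact dvd_sub hdvd (hFinf.mul_left _)
  have hRmom : ∀ d : ℕ, 1 ≤ d → d < (p - 1) / 2 →
      ∑ n ∈ Finset.range p, R.coeff n * (n : K) ^ (p - 1 - d) = 0 := by
    intro d hd1 hdM
    have h1 := hmom d hd1 hdM
    have h2 := hFmom d hd1 hdM
    rw [hRdef]
    simp only [coeff_sub, coeff_C_mul, sub_mul, mul_assoc]
    rw [sum_sub_distrib, ← mul_sum, h1, h2, mul_zero, sub_zero]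
  -- `R = 0`: otherwise the joint support bound gives `p - 1 ≤ #supp R ≤ p - 2`
  have hR : R = 0 := by
    by_contra hRne
    have hle := twoCuspJointSupport K p R ((p - 1) / 2) hRne hRdeg hRdvd (fun _ => hR0) hRmom
    have hsub : R.support ⊆ ((range p).erase 0).erase 1 := by
      intro n hn
      rw [mem_erase, mem_erase, mem_range]
      refine ⟨?_, ?_, lt_of_le_of_lt (le_natDegree_of_mem_supp n hn) hRdeg⟩
      · rintro rfl
        exact (mem_support_iff.mp hn) hR1
      · rintro rfl
        exact (mem_support_iff.mp hn) hR0
    have hcard := card_le_card hsub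
    rw [card_erase_of_mem (mem_erase.mpr ⟨one_ne_zero, mem_range.mpr hp.one_lt⟩),
      card_erase_of_mem (mem_range.mpr hp.pos), card_range] at hcard
    have h2 := hp.two_le
    omega
  have hPe : P = C (P.coeff 1) * F := by
    rw [hRdef] at hR
    exact sub_eq_zero.mp hR
  refine ⟨P.coeff 1, fun h0 => hP ?_, hPe⟩
  rw [hPe, h0, C_0, zero_mul]

end Summit.ValiantsHypothesis.ValiantsHypothesis.Theorems.CharPSparseSOSTwoCusp
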